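import Mathlib
import Summits.Ventures.PercRepro2.LocRows
import Summits.Ventures.PercRepro2.SwRow
import Summits.Ventures.PercRepro2.SwOut
import Summits.Ventures.PercRepro2.SwAllRow
import Summits.Ventures.PercRepro2.SwOutAll
import Summits.Ventures.PercRepro2.SwOutArmFlip
import Summits.Ventures.PercRepro2.SwOutArmThm
import Summits.Ventures.PercRepro2.SwOutCoreDefs
import Summits.Ventures.PercRepro2.SwOutBigBlockDefs
import Summits.Ventures.PercRepro2.SwOutMixedBaseDefs
import Summits.Ventures.PercRepro2.SwOutMixedBaseClasses
import Summits.Ventures.PercRepro2.SwOutMixedBaseHull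
import Summits.Ventures.PercRepro2.SwOutMixedBaseDual
import Summits.Ventures.PercRepro2.SwOutMixedCore
import Summits.Ventures.PercRepro2.SwOutMixedCorePieces
import Summits.Ventures.PercRepro2.SwOutMixedCoreLower
import Summits.Ventures.PercRepro2.SwOutMixedCoreThm
import Summits.Ventures.PercRepro2.SwOutMixedCoreEdgeMap
import Summits.Ventures.PercRepro2.SwOutMixedCoreMoveUP
import Summits.Ventures.PercRepro2.SwOutMixedCoreFlipGeneric

/-!
# Block-lowerness of the conditioning on the mixed single junction (blind cell PercRepro2,
night-4 g18, 2026-08-27; proofs/NIGHT4-G18.md §5 — item (G3) of NIGHT4-G17.md §4⁗′, CLOSED)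

**Theorem** `blockLower_tgtU`: on the non-leaking points of the raw cube, the pulled-back
conditioning `{q | mixedReal σ q ∈ tgtU l h {o ∈ ·}}` is LOWER (`BlockLower`, the hypothesis of
`mixedCore_card_le'` / `card_le_of_mixedCore_edges`), for every mixed base whose region `Us`
contains `h`, `u`, `p` and the arms and not `l`, with `o ≠ u`.

Proof: for non-leaking `q' ≤ q`, either the u–p edges do not turn blue or some u-arm is red at `q`
and some blue at `q'` — the generic move `mem_tgtU_of_le`; otherwise the u-arms are all blue at
`q` (then `q' = (⊥, 0, 0, 0, f')`: pass through `(⊥, 0, 1, 0, f')` by the generic move and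
`mem_tgtU_toggleUP_bot`) or all red at `q'` (then `q = (⊤, 1, 1, 1, f)`: pass through
`(⊤, 1, 0, 1, f)` by `mem_tgtU_toggleUP_top` and the generic move).
-/

namespace Summit.Ventures.PercRepro2

namespace BigBlock

open Hull LocRows

variable {V : Type*} {E : Type*}

section BlockLower

variable {ι κ : Type*} {ends : E → Sym2 V} {σ : Config E} {h u p : V} {U : ι → Set V} {Ah : Set V}
  {F : κ → Set V} (hb : MixedBase ends σ h u p U Ah F)
include hb

/-- **Block-lowerness of the conditioning** (the (G3) moves, all of them). -/
theorem MixedBase.blockLower_tgtU [Fintype E] [DecidableEq E] [Nonempty ι]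
    (hup : ∃ e, ends e = s(u, p)) {Us : Set V} {l o : V}
    (hUs : {h} ∪ {u} ∪ {p} ∪ armsAll U Ah F ⊆ Us) (hl : l ∉ Us) (hou : o ≠ u) :
    BlockLower {q : Pt ι κ | mixedReal ends u p U Ah F σ q ∈ tgtU ends l h {S : Set V | o ∈ S}} := by
  intro q q' hq hq' hle hQ
  simp only [Set.mem_setOf_eq] at hQ ⊢
  rw [leak'_iff, not_or] at hq hq'
  obtain ⟨hqR, hqB⟩ := hq
  obtain ⟨hqR', hqB'⟩ := hq'
  obtain ⟨j₀⟩ := (inferInstance : Nonempty ι)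
  by_cases huP : q'.2.2.1 = q.2.2.1
  · exact hb.mem_tgtU_of_le hup hUs hl hle hqR hqB' hqR' hqB' (Or.inl huP) hQ
  -- the u–p edges turn blue
  have hq1 : q.2.2.1 = true := by
    have := hle.2.2.1
    cases hq1 : q.2.2.1
    · rw [hq1] at this
      cases hq1' : q'.2.2.1
      · exact absurd (hq1' ▸ hq1 ▸ rfl) huP
      · rw [hq1'] at this; exact absurd this (by decide)
    · rfl
  have hq0 : q'.2.2.1 = false := by
    cases hq1' : q'.2.2.1
    · rfl
    · exact absurd (hq1' ▸ hq1 ▸ rfl) huP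
  by_cases hs : ∃ j, q.1 j = true
  · by_cases hs' : ∃ j, q'.1 j = false
    · exact hb.mem_tgtU_of_le hup hUs hl hle hqR hqB' hqR' hqB' (Or.inr ⟨hs, hs'⟩) hQ
    · -- every u-arm red at `q'` (hence at `q`): `q = (⊤, 1, 1, 1, f)`
      have hs'' : ∀ j, q'.1 j = true := by
        intro j
        cases hj : q'.1 j
        · exact absurd ⟨j, hj⟩ hs'
        · rfl
      have hsq : ∀ j, q.1 j = true := fun j => Bool.le_iff_imp.1 (hle.1 j) (hs'' j)
      have hae : q.2.1 = true ∧ q.2.2.2.1 = true := by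
        by_contra hne
        apply hqR
        refine ⟨⟨j₀, hsq j₀⟩, hq1, ?_⟩
        cases ha : q.2.1 <;> cases he : q.2.2.2.1
        · exact Or.inl rfl
        · exact Or.inr rfl
        · exact Or.inl rfl
        · exact absurd ⟨ha, he⟩ hne
      -- step 1: `q → toggleUP q = (⊤, 1, 0, 1, f)`
      have h1 := hb.mem_tgtU_toggleUP_top hup hUs hl hou hsq hae.1 hq1 hae.2 hQ
      -- step 2: `toggleUP q → q'` by the generic move (the u–p edges blue on both sides)
      have hmR : ¬ LeakR (toggleUP q) := by
        rintro ⟨_, h2, _⟩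
        simp [toggleUP, hq1] at h2
      have hmB : ¬ LeakB (toggleUP q) := by
        rintro ⟨⟨j, hj⟩, _, _⟩
        simp [toggleUP, flipPt, flipAll, hsq j] at hj
      refine hb.mem_tgtU_of_le hup hUs hl ?_ hmR hqB' hqR' hqB' (Or.inl ?_) h1
      · exact ⟨hle.1, hle.2.1, by simp [toggleUP, hq1, hq0], hle.2.2.2.1, hle.2.2.2.2⟩
      · simp [toggleUP, hq1, hq0]
  · -- every u-arm blue at `q` (hence at `q'`): `q' = (⊥, 0, 0, 0, f')`
    have hsq : ∀ j, q.1 j = false := by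
      intro j
      cases hj : q.1 j
      · rfl
      · exact absurd ⟨j, hj⟩ hs
    have hsq' : ∀ j, q'.1 j = false := fun j => by
      have := Bool.le_iff_imp.1 (hle.1 j)
      cases hj : q'.1 j
      · rfl
      · exact absurd (this hj) (by rw [hsq j]; decide)
    have hae : q'.2.1 = false ∧ q'.2.2.2.1 = false := by
      by_contra hne
      apply hqB'
      refine ⟨⟨j₀, by simp [flipPt, flipAll, hsq' j₀]⟩, by simp [flipPt, hq0], ?_⟩
      cases ha : q'.2.1 <;> cases he : q'.2.2.2.1
      · exact absurd ⟨ha, he⟩ hne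
      · exact Or.inl (by simp [flipPt, he])
      · exact Or.inr (by simp [flipPt, ha])
      · exact Or.inl (by simp [flipPt, he])
    -- the intermediate point `m = (⊥, 0, 1, 0, f')`
    set m : Pt ι κ := (q'.1, false, true, false, q'.2.2.2.2) with hm
    have hmR : ¬ LeakR m := by
      rintro ⟨⟨j, hj⟩, _, _⟩
      simp [hm, hsq' j] at hj
    have hmB : ¬ LeakB m := by
      rintro ⟨_, h2, _⟩
      simp [hm, flipPt] at h2
    -- step 1: `q → m` by the generic move (the u–p edges red on both sides)
    have h1 : mixedReal ends u p U Ah F σ m ∈ tgtU ends l h {S : Set V | o ∈ S} := by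
      refine hb.mem_tgtU_of_le hup hUs hl ?_ hqR hmB hmR hmB (Or.inl ?_) hQ
      · exact ⟨hle.1, Bool.false_le _, by simp [hm, hq1], Bool.false_le _, hle.2.2.2.2⟩
      · simp [hm, hq1]
    -- step 2: `m → toggleUP m = q'`
    have h2 := hb.mem_tgtU_toggleUP_bot hup hUs hl hou (q := m) hsq' rfl rfl rfl h1
    have hq'eq : toggleUP m = q' := by
      obtain ⟨s', a', uP', e', f'⟩ := q'
      simp only at hq0 hae
      simp only [toggleUP, hm, Prod.mk.injEq, true_and, and_true]
      exact ⟨hae.1.symm, hq0.symm, hae.2.symm⟩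
    rw [hq'eq] at h2
    exact h2

end BlockLower

end BigBlock

end Summit.Ventures.PercRepro2
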